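import Literature.Probability.RandomPlanarGeometry.SAWTriangularBridges
import Literature.Probability.RandomPlanarGeometry.SAWTriangularRatioEngine
import HarnessLib

/-!
# `b_n(𝕋) ≤ μ(𝕋)^n`: bridges of the triangular lattice grow no faster than `μ(𝕋)`

Topic `Literature/Probability/RandomPlanarGeometry` (continues `SAWTriangularBridges.lean`). Source:
N. Madras, G. Slade, *The Self-Avoiding Walk* (1993), §1.2, (1.2.15)–(1.2.17): "`b_N ≤ μ_{Bridge}^N ≤ μ^N`"
from the supermultiplicativity of bridge counts — there for `ℤ^d`; for a graph with a graph height
function the inequality `β ≤ μ` is the trivial half of Grimmett–Li's bridge theorem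
[cite: GrimmettLi2018Locality, Theorem 4.3]. The proof is the tree's `Zd.bridgeCount_le_pow` verbatim:
`b_nᵏ ≤ b_{kn} ≤ c_{kn}`, so `b_n ≤ (c_{kn}^{1/(kn)})ⁿ → μ(𝕋)ⁿ` (`tendsto_triSawCount_rpow`, Fekete).

## Contents (namespace `Literature.Probability.RandomPlanarGeometry.SAW`)

* `brickBridgeCount_pow_le : b_n(𝕋)^k ≤ b_{kn}(𝕋)`;
* `triSawCount_zero : c_0(𝕋) = 1`, `brickBridgeCount_zero : b_0(𝕋) = 1`;
* **`brickBridgeCount_le_pow : b_n(𝕋) ≤ μ(𝕋)^n`** (`μ(𝕋) = exp logMuTri`).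
-/

noncomputable section

open Finset Filter Topology Literature.Probability.LatticeModels Literature.Probability.Percolation
open scoped BigOperators

namespace Literature.Probability.RandomPlanarGeometry.SAW

/-- `b_n(𝕋)ᵏ ≤ b_{kn}(𝕋)`: concatenate `k` bridges. [cite: MadrasSlade1993, §1.2, eq. (1.2.15)] -/
theorem brickBridgeCount_pow_le (n k : ℕ) : brickBridgeCount n ^ k ≤ brickBridgeCount (k * n) := by
  induction k with
  | zero => simpa using one_le_brickBridgeCount 0
  | succ k ih =>
    calc brickBridgeCount n ^ (k + 1) = brickBridgeCount n ^ k * brickBridgeCount n := pow_succ _ _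
      _ ≤ brickBridgeCount (k * n) * brickBridgeCount n := Nat.mul_le_mul_right _ ih
      _ ≤ brickBridgeCount (k * n + n) := brickBridgeCount_mul_le _ _
      _ = brickBridgeCount ((k + 1) * n) := by rw [Nat.succ_mul]

/-- `c_0(𝕋) = 1` (the empty walk). [cite: MadrasSlade1993, §1.1] -/
theorem triSawCount_zero : triSawCount 0 = 1 := by
  rw [triSawCount_eq_ncard]
  have : sawLists triGraph (0 : Site 2) 0 = {[0]} := by
    ext l
    constructor
    · rintro ⟨-, hh, hl, -⟩
      match l, hh, hl with
      | [a], hh, _ => simp at hh; simp [hh]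
    · rintro rfl; exact ⟨List.isChain_singleton _, rfl, rfl, List.nodup_singleton _⟩
  rw [this, Set.ncard_singleton]

/-- `b_0(𝕋) = 1`. [cite: MadrasSlade1993, §1.2] -/
theorem brickBridgeCount_zero : brickBridgeCount 0 = 1 :=
  le_antisymm ((brickBridgeCount_le_triSawCount 0).trans triSawCount_zero.le) (one_le_brickBridgeCount 0)

/-- **`b_n(𝕋) ≤ μ(𝕋)^n`** (Madras–Slade (1.2.17) on `𝕋`: "`b_N ≤ μ_{Bridge}^N ≤ μ^N`"): from
`b_nᵏ ≤ b_{kn} ≤ c_{kn}`, `b_n ≤ (c_{kn}^{1/(kn)})ⁿ`, and `c_m(𝕋)^{1/m} → μ(𝕋)`.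
[cite: MadrasSlade1993, §1.2, eq. (1.2.17)] -/
theorem brickBridgeCount_le_pow (n : ℕ) : (brickBridgeCount n : ℝ) ≤ Real.exp logMuTri ^ n := by
  rcases Nat.eq_zero_or_pos n with rfl | hn
  · simp [brickBridgeCount_zero]
  have hsub : Tendsto (fun k : ℕ => k * n) atTop atTop :=
    tendsto_id.atTop_mul_const' hn
  have hlim : Tendsto (fun k : ℕ => ((triSawCount (k * n) : ℝ) ^ (1 / ((k * n : ℕ) : ℝ))) ^ n) atTop
      (𝓝 (Real.exp logMuTri ^ n)) :=
    (tendsto_triSawCount_rpow.comp hsub).pow n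
  refine ge_of_tendsto hlim ?_
  filter_upwards [eventually_ge_atTop 1] with k hk
  have hkn : (k * n : ℕ) ≠ 0 := Nat.mul_ne_zero (by omega) hn.ne'
  have hb0 : (0 : ℝ) ≤ brickBridgeCount n := Nat.cast_nonneg _
  have hc0 : (0 : ℝ) ≤ triSawCount (k * n) := Nat.cast_nonneg _
  have hpow : ((brickBridgeCount n : ℝ)) ^ (k * n) ≤
      (((triSawCount (k * n) : ℝ) ^ (1 / ((k * n : ℕ) : ℝ))) ^ n) ^ (k * n) := by
    have h1 : ((brickBridgeCount n : ℝ)) ^ (k * n) = ((brickBridgeCount n : ℝ) ^ k) ^ n := by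
      rw [← pow_mul]
    have h2 : (((triSawCount (k * n) : ℝ) ^ (1 / ((k * n : ℕ) : ℝ))) ^ n) ^ (k * n) =
        (triSawCount (k * n) : ℝ) ^ n := by
      rw [← pow_mul, mul_comm n (k * n), pow_mul, one_div, Real.rpow_inv_natCast_pow hc0 hkn]
    rw [h1, h2]
    refine pow_le_pow_left₀ (pow_nonneg hb0 _) ?_ n
    exact_mod_cast (brickBridgeCount_pow_le n k).trans (brickBridgeCount_le_triSawCount (k * n))
  exact le_of_pow_le_pow_left₀ hkn (pow_nonneg (Real.rpow_nonneg hc0 _) _) hpow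

end Literature.Probability.RandomPlanarGeometry.SAW
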